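import Literature.MathematicalPhysics.QuantumLattice.InfiniteVolumeProofs
import Literature.MathematicalPhysics.QuantumLattice.QuasiLocalAlgebraDynamicsProofs
import HarnessLib

/-!
# Translation covariance of infinite-volume ground states; a unique ground state is translation
# invariant

Trunk **T-QLATTICE**. Proof file behind the named fact
`Literature.MathematicalPhysics.QuantumLattice.no_unique_gapped_groundState_halfOddSpin`
(`InfiniteVolume.lean`). The first step of the Affleck–Lieb argument (Tasaki 2022, before
Cor. 3.6: "the (global) uniqueness implies that the ground state is invariant under translation")
is recorded here for a general translation-invariant interaction `Φ` on `ℤ^d`: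

* `transportOp_shift_embedOp` — lattice translations commute with isotony,
  `τ_v (A ⊗ 𝟙_{Λ'∖Λ}) = τ_v(A) ⊗ 𝟙_{(Λ'+v)∖(Λ+v)}`;
* `transportOp_shift_localHamiltonian` — for translation-invariant `Φ`, `τ_v (H_S) = H_{S+v}`
  (`H_S = Σ_{Y ⊆ S} Φ Y`), hence `transportOp_shift_derivation`: `τ_v (δ_Λ(A)) = δ_{Λ+v}(τ_v A)`;
* `InfVolState.IsGroundState.shift` — **translates of ground states are ground states**:
  `ω ∘ τ_v` satisfies `-i (ω∘τ_v)(Aᴴ δ(A)) = -i ω(τ_v(A)ᴴ δ(τ_v A)) ≥ 0`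
  (Bratteli–Robinson II §6.2.7: the set of ground states of a translation-invariant interaction is
  translation invariant);
* `HasUniqueGroundState.shift_eq` / `HasUniqueGroundState.expect_map_shift_transportOp` — **a
  unique ground state is translation invariant**: `ω ∘ τ_v = ω`, i.e.
  `ω_{Λ+v}(τ_v A) = ω_Λ(A)` for all local `A` (Tasaki 2022 §3.2, eq. (3.12), and the discussion
  before Cor. 3.6; Affleck–Lieb 1986 §2).

No statement of any other file is changed and no definition is introduced; the lattice
combinatorics `thicken_map_shift` (`(Λ+v)_R = (Λ_R)+v`), `map_shift_map_shift_neg`,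
`map_shift_neg_map_shift` are imported from `QuasiLocalAlgebraDynamicsProofs.lean`.

## References

* H. Tasaki, *The Lieb–Schultz–Mattis theorem. A topological point of view*, in: The Physics
  and Mathematics of Elliott Lieb, vol. 2, EMS Press (2022) 405–446, arXiv:2202.06243 (held),
  §3.2 eq. (3.12) (translation invariance of the state) and the paragraph before Cor. 3.6
  (uniqueness implies translation invariance). [Tasaki2022]
* I. Affleck, E. H. Lieb, *A proof of part of Haldane's conjecture on spin chains*,
  Lett. Math. Phys. 12 (1986) 57–69, §2. [AffleckLieb1986]
* O. Bratteli, D. W. Robinson, *Operator Algebras and Quantum Statistical Mechanics 2*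
  (2nd ed., Springer 1997), §6.2.1 eq. (6.2.2)–(6.2.3) (space translations, covariant
  interactions), §6.2.7 (ground states of spin systems). [BratteliRobinsonII1997]
-/

noncomputable section

open Matrix Complex Finset
open scoped ComplexOrder

namespace Literature.MathematicalPhysics.QuantumLattice

open Literature.Probability.LatticeModels
open Literature.Probability.LatticeModels (Site box mem_box)

variable {d q : ℕ}

/-! ### Translations commute with isotony -/

/-- Entries of a transported matrix: `⟨σ| τ_e A |τ⟩ = ⟨σ ∘ e| A |τ ∘ e⟩`.
Bratteli–Robinson II §6.2.1, eq. (6.2.2). [folklore] -/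
theorem transportOp_apply {X Y : Type*} (e : X ≃ Y) (A : Matrix (X → Fin q) (X → Fin q) ℂ)
    (σ τ : Y → Fin q) : transportOp e A σ τ = A (fun x => σ (e x)) (fun x => τ (e x)) := by
  simp only [transportOp, reindex_apply, submatrix_apply, Equiv.arrowCongr_symm, Equiv.refl_symm]
  rfl

/-- Transport of configuration matrices commutes with scalars. Bratteli–Robinson II §6.2.1.
[folklore] -/
theorem transportOp_smul {X Y : Type*} [Fintype X] [DecidableEq X] [Fintype Y] [DecidableEq Y]
    (e : X ≃ Y) (c : ℂ) (A : Matrix (X → Fin q) (X → Fin q) ℂ) :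
    transportOp e (c • A) = c • transportOp e A := by
  rw [transportOp_eq_reindexAlgEquiv, map_smul, ← transportOp_eq_reindexAlgEquiv]

/-- Transport of configuration matrices is compatible with subtraction.
Bratteli–Robinson II §6.2.1. [folklore] -/
theorem transportOp_sub {X Y : Type*} [Fintype X] [DecidableEq X] [Fintype Y] [DecidableEq Y]
    (e : X ≃ Y) (A B : Matrix (X → Fin q) (X → Fin q) ℂ) :
    transportOp e (A - B) = transportOp e A - transportOp e B := by
  rw [transportOp_eq_reindexAlgEquiv, map_sub, ← transportOp_eq_reindexAlgEquiv,
    ← transportOp_eq_reindexAlgEquiv]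

/-- **Lattice translations commute with isotony**: for `Λ ⊆ Λ'` and `A ∈ 𝔄_Λ`,
`τ_v (A ⊗ 𝟙_{Λ'∖Λ}) = τ_v(A) ⊗ 𝟙_{(Λ'+v)∖(Λ+v)}`. Bratteli–Robinson II §6.2.1 (eqs. (6.2.2),
isotony and covariance). [folklore] -/
theorem transportOp_shift_embedOp {Λ Λ' : Finset (Site d)} (h : Λ ⊆ Λ') (v : Site d)
    (A : Op ↥Λ q) :
    transportOp (finsetMapEquiv (Site.shift v).toEmbedding Λ') (embedOp h A) =
      embedOp (Finset.map_subset_map.2 h)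
        (transportOp (finsetMapEquiv (Site.shift v).toEmbedding Λ) A) := by
  ext σ τ
  rw [transportOp_apply, embedOp, of_apply, embedOp, of_apply, transportOp_apply]
  refine if_congr ?_ rfl rfl
  refine Equiv.forall_congr (finsetMapEquiv (Site.shift v).toEmbedding Λ') fun y => ?_
  rw [coe_finsetMapEquiv_apply, Finset.mem_map' (Site.shift v).toEmbedding]

/-! ### Translation covariance of the `R`-neighbourhood and of the local Hamiltonians -/

/-- **Translation covariance of the local Hamiltonians**: for a translation-invariant
interaction, `τ_v (H_S) = H_{S+v}` where `H_S = Σ_{Y ⊆ S} Φ Y ⊗ 𝟙_{S∖Y}`.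
Bratteli–Robinson II §6.2.1, eqs. (6.2.3)–(6.2.4). [folklore] -/
theorem transportOp_shift_localHamiltonian {Φ : LatticeInteraction d q}
    (hΦ : Φ.IsTranslationInvariant) (S : Finset (Site d)) (v : Site d) :
    transportOp (finsetMapEquiv (Site.shift v).toEmbedding S) (localHamiltonian (Φ.restrict S) univ) =
      localHamiltonian (Φ.restrict (S.map (Site.shift v).toEmbedding)) univ := by
  rw [localHamiltonian_restrict_eq_sum, localHamiltonian_restrict_eq_sum,
    transportOp_eq_reindexAlgEquiv, map_sum]
  symm
  refine Finset.sum_nbij' (fun Y => Y.map (Site.shift (-v)).toEmbedding)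
    (fun Y => Y.map (Site.shift v).toEmbedding) ?_ ?_ ?_ ?_ ?_
  · intro Y hY
    rw [mem_powerset] at hY ⊢
    simpa only [map_shift_map_shift_neg] using
      (Finset.map_subset_map (f := (Site.shift (-v)).toEmbedding)).2 hY
  · intro Y hY
    rw [mem_powerset] at hY ⊢
    exact Finset.map_subset_map.2 hY
  · intro Y _
    exact map_shift_neg_map_shift Y v
  · intro Y _
    exact map_shift_map_shift_neg Y v
  · intro Y hY
    rw [mem_powerset] at hY
    have hY' : Y.map (Site.shift (-v)).toEmbedding ⊆ S := by
      simpa only [map_shift_map_shift_neg] using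
        (Finset.map_subset_map (f := (Site.shift (-v)).toEmbedding)).2 hY
    rw [dif_pos hY, dif_pos hY', ← transportOp_eq_reindexAlgEquiv, transportOp_shift_embedOp,
      ← hΦ v]
    -- both sides are `embedOp _ (Φ _)` at the regions `Y` and `(Y - v) + v = Y`
    have key : ∀ (Y₁ Y₂ : Finset (Site d)) (e : Y₁ = Y₂) (h₁ : Y₁ ⊆ S.map (Site.shift v).toEmbedding)
        (h₂ : Y₂ ⊆ S.map (Site.shift v).toEmbedding), embedOp h₁ (Φ Y₁) = embedOp h₂ (Φ Y₂) := by
      rintro Y₁ Y₂ rfl h₁ h₂; rfl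
    exact key _ _ (map_shift_neg_map_shift Y v).symm _ _

/-- **Translation covariance of the generator**: for a translation-invariant interaction,
`τ_v (δ_Λ(A)) ⊗ 𝟙 = δ_{Λ+v}(τ_v A)` in `𝔄_{(Λ+v)_R}` (the left-hand side lives on `(Λ_R) + v`,
which equals `(Λ+v)_R`, `thicken_map_shift`; the identification is the isotony map along this
equality). Bratteli–Robinson II §6.2.1, Thm. 6.2.4 (covariance of the dynamics,
`τ_x α_t = α_t τ_x` for translation-invariant `Φ`). [folklore] -/
theorem transportOp_shift_derivation {Φ : LatticeInteraction d q} (hΦ : Φ.IsTranslationInvariant)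
    (R : ℝ) (Λ : Finset (Site d)) (v : Site d) (A : Op ↥Λ q)
    (hS : (thicken Λ R).map (Site.shift v).toEmbedding ⊆
      thicken (Λ.map (Site.shift v).toEmbedding) R) :
    embedOp hS (transportOp (finsetMapEquiv (Site.shift v).toEmbedding (thicken Λ R))
        (derivation Φ R Λ A)) =
      derivation Φ R (Λ.map (Site.shift v).toEmbedding)
        (transportOp (finsetMapEquiv (Site.shift v).toEmbedding Λ) A) := by
  have hH : embedOp hS (transportOp (finsetMapEquiv (Site.shift v).toEmbedding (thicken Λ R))
      (localHamiltonian (Φ.restrict (thicken Λ R)) univ)) =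
      localHamiltonian (Φ.restrict (thicken (Λ.map (Site.shift v).toEmbedding) R)) univ := by
    rw [transportOp_shift_localHamiltonian hΦ, embedOp_localHamiltonian_restrict,
      localHamiltonian_restrict_eq_sum, ← thicken_map_shift]
  have hA : embedOp hS (transportOp (finsetMapEquiv (Site.shift v).toEmbedding (thicken Λ R))
      (embedOp (subset_thicken Λ R) A)) =
      embedOp (subset_thicken (Λ.map (Site.shift v).toEmbedding) R)
        (transportOp (finsetMapEquiv (Site.shift v).toEmbedding Λ) A) := by
    rw [transportOp_shift_embedOp, embedOp_embedOp]
  rw [derivation, derivation, transportOp_smul, transportOp_sub, transportOp_mul, transportOp_mul,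
    embedOp_smul, embedOp_sub, embedOp_mul, embedOp_mul, hH, hA]

/-! ### Translates of ground states; uniqueness implies translation invariance -/

/-- **Translates of ground states are ground states.** For a translation-invariant interaction
`Φ` (range parameter `R`) and an infinite-volume ground state `ω`, the translated state
`ω ∘ τ_v` (`InfVolState.shift v ω`) is again a ground state:
`-i (ω ∘ τ_v)(Aᴴ δ_Λ(A)) = -i ω(τ_v(A)ᴴ δ_{Λ+v}(τ_v A)) ≥ 0` by translation covariance of the
generator (`transportOp_shift_derivation`) and of isotony. Bratteli–Robinson II §6.2.7 (the
ground states of a translation-invariant interaction form a translation-invariant set);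
Tasaki (2022) §3.2. [cite: BratteliRobinsonII1997, §6.2.7] -/
theorem InfVolState.IsGroundState.shift {ω : InfVolState d q} {Φ : LatticeInteraction d q}
    {R : ℝ} (hω : ω.IsGroundState Φ R) (hΦ : Φ.IsTranslationInvariant) (v : Site d) :
    (ω.shift v).IsGroundState Φ R := by
  intro Λ A
  have hS : (thicken Λ R).map (Site.shift v).toEmbedding ⊆
      thicken (Λ.map (Site.shift v).toEmbedding) R := (thicken_map_shift Λ R v).ge
  have h := hω (Λ.map (Site.shift v).toEmbedding)
    (transportOp (finsetMapEquiv (Site.shift v).toEmbedding Λ) A)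
  rw [InfVolState.shift_expect, ← ω.compatible hS, transportOp_mul, transportOp_conjTranspose,
    embedOp_mul, embedOp_conjTranspose, transportOp_shift_derivation hΦ R Λ v A hS,
    transportOp_shift_embedOp, embedOp_embedOp]
  exact h

/-- Translates of ground states are ground states, in `groundStates` form.
Bratteli–Robinson II §6.2.7. [cite: BratteliRobinsonII1997, §6.2.7] -/
theorem shift_mem_groundStates {ω : InfVolState d q} {Φ : LatticeInteraction d q} {R : ℝ}
    (hω : ω ∈ groundStates Φ R) (hΦ : Φ.IsTranslationInvariant) (v : Site d) :
    ω.shift v ∈ groundStates Φ R :=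
  InfVolState.IsGroundState.shift hω hΦ v

/-- **A unique ground state is translation invariant**: if `Φ` is translation invariant and has a
unique infinite-volume ground state, then that ground state `ω` satisfies `ω ∘ τ_v = ω` for every
`v ∈ ℤ^d`. Tasaki (2022), paragraph before Cor. 3.6 ("the (global) uniqueness implies that the
ground state is invariant under translation"); Affleck–Lieb (1986) §2.
[cite: Tasaki2022, §3.2 (before Cor. 3.6)] -/
theorem HasUniqueGroundState.shift_eq {Φ : LatticeInteraction d q} {R : ℝ}
    (hU : HasUniqueGroundState Φ R) (hΦ : Φ.IsTranslationInvariant) {ω : InfVolState d q}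
    (hω : ω ∈ groundStates Φ R) (v : Site d) : ω.shift v = ω := by
  obtain ⟨ω₀, -, huniq⟩ := hU
  exact (huniq _ (shift_mem_groundStates hω hΦ v)).trans (huniq ω hω).symm

/-- **Translation invariance of the unique ground state, on local observables**:
`ω_{Λ+v}(τ_v A) = ω_Λ(A)` for every region `Λ`, local observable `A ∈ 𝔄_Λ` and `v ∈ ℤ^d`
(Tasaki 2022, eq. (3.12): `ω(𝒯_p(Â)) = ω(Â)`). [cite: Tasaki2022, §3.2 eq. (3.12)] -/
theorem HasUniqueGroundState.expect_map_shift_transportOp {Φ : LatticeInteraction d q} {R : ℝ}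
    (hU : HasUniqueGroundState Φ R) (hΦ : Φ.IsTranslationInvariant) {ω : InfVolState d q}
    (hω : ω ∈ groundStates Φ R) (v : Site d) (Λ : Finset (Site d)) (A : Op ↥Λ q) :
    ω.expect (Λ.map (Site.shift v).toEmbedding)
        (transportOp (finsetMapEquiv (Site.shift v).toEmbedding Λ) A) = ω.expect Λ A := by
  rw [← InfVolState.shift_expect, hU.shift_eq hΦ hω v]

end Literature.MathematicalPhysics.QuantumLattice
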